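import Summits.QuantumAdvantage.QuantumAdvantage.Theorems.NearExactIsExact.Negative.TypeOSixtyOneFourteen
import Summits.QuantumAdvantage.QuantumAdvantage.Theorems.NearExactIsExact.Negative.LevelSixSixtyOneFourteen

/-!
# `θ₁₄ ≤ 61/64`: above `61/64` a cubic pair on 14 bits is exact (NearExactIsExact, disprover gen 24)

Negative/structural theorem for the crux `CubicForrelation.NearExactIsExact` (item r2), finite slice `n = 14`.
HONEST FRAMING: a DECIDABLE-IN-PRINCIPLE VERDICT about cubic Boolean functions on 14 bits, proved structurally —
NOT summit progress, no violation of `NearExactIsExact`, nothing about the asymptotic constant `θ`.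

The tree had `θ₁₄ ∈ [57/64, 31/32)` (`theta_fourteen_halfopen`), the window `(57/64, 31/32)` open.  This file closes
`(61/64, 1)`: for cubic `f, g : 𝔽₂¹⁴ → 𝔽₂`, `Φ(f,g) > 61/64 ⇒ Φ(f,g) = 1` (`isolation_fourteen_61`), hence
`θ₁₄ ∈ [57/64, 61/64]` (`theta_fourteen_window_61`).  Assembly (all inputs in the tree or in the sibling `Negative/` files):
* by Ax (`tw_base`) `W_g = 32u_g`, `W_f = 32u_f`; a TYPE-O side (all values odd) caps `Φ ≤ 61/64`
  (`…Negative.TypeOSixtyOneFourteen.no_typeO_above_61`: digits `d₁ = d₂` somewhere costs `3/64`, case A costs `5/64`);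
* an even side is at level 6 proper, or at level `≥ 7` where `fo_levelSeven` gives `Φ = 1` or (bent) `Φ = 15/16 < 61/64`;
* two level-6 proper sides contradict `…Negative.LevelSixSixtyOneFourteen.levelSix_pair_false_61` (mod-4 character argument).
The remaining window `(57/64, 61/64]` at `n = 14` is OPEN; `61/64` would need a type-O side with `#{d₁ = d₂} = 2¹⁰` exactly.

Sources: [this work]; standard axioms only.
-/

set_option linter.dupNamespace false -- D-0017: single-problem summit ⇒ `QuantumAdvantage.QuantumAdvantage` by design

noncomputable section

namespace Summit.QuantumAdvantage.QuantumAdvantage.Theorems.NearExactIsExact.Negative.ThetaFourteenSixtyOne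

open Finset
open Literature.Computability.QuantumComplexity
open Literature.Computability.QuantumComplexity.DerivativeWalsh (W)
open Summit.QuantumAdvantage.QuantumAdvantage.Theorems.CubicForrelation.NearExactIsExact
open Summit.QuantumAdvantage.QuantumAdvantage.Theorems.SignedCubicForrelationNotPrBPP.Negative.HalfQuad (forrelation_comm)
open Summit.QuantumAdvantage.QuantumAdvantage.Theorems.NearExactIsExact.Negative.TypeOSixtyOneFourteen (no_typeO_above_61)
open Summit.QuantumAdvantage.QuantumAdvantage.Theorems.NearExactIsExact.Negative.LevelSixSixtyOneFourteen
  (levelSix_pair_false_61)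

/-- An EVEN side above `61/64` of a non-exact cubic pair on 14 bits is at level 6 proper: `W_g = 64u'` with some `u'(x)` odd
(level `≥ 7` would give `Φ = 1` or the bent value `15/16 < 61/64`, `fo_levelSeven`).  NOT summit progress. [this work] -/
theorem even_side_levelSix (f g : (Fin (7 + 7) → Bool) → Bool) (hf : IsDegLeFun 3 f) (hg : IsDegLeFun 3 g)
    (hΦ : (61 / 64 : ℝ) < forrelation f g) (hne : forrelation f g ≠ 1)
    (u : (Fin (7 + 7) → Bool) → ℤ) (hu : ∀ x, W (fun y => signOf (g y)) x = (2 : ℝ) ^ 5 * (u x : ℝ))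
    (hev : ∃ x, ¬ Odd (u x)) :
    ∃ u' : (Fin (7 + 7) → Bool) → ℤ, (∀ x, W (fun y => signOf (g y)) x = (2 : ℝ) ^ 6 * (u' x : ℝ)) ∧ ∃ x, Odd (u' x) := by
  obtain ⟨x₀, hx₀⟩ := hev
  have hev' : ∀ x, ¬ Odd (u x) := fun x h => hx₀ ((fd_parity_const g u hg hu x x₀).1 h)
  have hu6 := tw_level_up g u hu hev'
  by_cases h6 : ∃ x, Odd (u x / 2)
  · exact ⟨fun x => u x / 2, hu6, h6⟩
  · push Not at h6
    have hu7 := tw_level_up g (fun x => u x / 2) hu6 h6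
    rcases fo_levelSeven f g hf hg _ hu7 (by linarith) with h | h
    · exact absurd h hne
    · exfalso
      linarith [h.2]

/-- **THEOREM θ₁₄ ≤ 61/64 (at the type `Fin (7 + 7)`).**  For cubic `f, g : 𝔽₂¹⁴ → 𝔽₂`: `Φ(f,g) > 61/64 ⇒ Φ(f,g) = 1`.
Finite-slice verdict; NOT summit progress. [this work] -/
theorem isolation_fourteen_61' (f g : (Fin (7 + 7) → Bool) → Bool) (hf : IsDegLeFun 3 f) (hg : IsDegLeFun 3 g)
    (hΦ : (61 / 64 : ℝ) < forrelation f g) : forrelation f g = 1 := by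
  classical
  by_contra hne
  obtain ⟨ug, hug⟩ := tw_base g hg 5 (by norm_num)
  obtain ⟨uf, huf⟩ := tw_base f hf 5 (by norm_num)
  have hΦ' : (61 / 64 : ℝ) < forrelation g f := by rw [forrelation_comm]; exact hΦ
  have hne' : forrelation g f ≠ 1 := by rw [forrelation_comm]; exact hne
  obtain ⟨hgev, hfev⟩ := no_typeO_above_61 f g hf hg hΦ ug uf hug huf
  obtain ⟨u', hu', hou'⟩ := even_side_levelSix f g hf hg hΦ hne ug hug hgev
  obtain ⟨v', hv', hov'⟩ := even_side_levelSix g f hg hf hΦ' hne' uf huf hfev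
  exact levelSix_pair_false_61 f g hf hg u' hu' v' hv' hou' hov' hΦ

/-- **THEOREM θ₁₄ ≤ 61/64.**  For all cubic `f, g : (Fin 14 → Bool) → Bool`: `61/64 < Φ(f,g) ⇒ Φ(f,g) = 1` — the value `61/64`
isolates exactness on 14 bits (the tree had `31/32`, then "some θ < 31/32").  Finite-slice verdict; NOT summit progress. [this work] -/
theorem isolation_fourteen_61 : ∀ f g : (Fin 14 → Bool) → Bool, IsDegLeFun 3 f → IsDegLeFun 3 g →
    (61 / 64 : ℝ) < forrelation f g → forrelation f g = 1 :=
  fun f g hf hg h => isolation_fourteen_61' f g hf hg h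

/-- **No cubic pair on 14 bits has a forrelation value in the open interval `(61/64, 1)`.**  NOT summit progress. [this work] -/
theorem no_value_between_61_and_one (f g : (Fin 14 → Bool) → Bool) (hf : IsDegLeFun 3 f) (hg : IsDegLeFun 3 g) :
    forrelation f g ≤ 61 / 64 ∨ forrelation f g = 1 := by
  by_cases h : (61 / 64 : ℝ) < forrelation f g
  · exact Or.inr (isolation_fourteen_61 f g hf hg h)
  · exact Or.inl (not_lt.1 h)

/-- **`θ₁₄ ∈ [57/64, 61/64]`** — the `n = 14` row of the ladder: the least isolation constant for cubic pairs on 14 bits exists,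
is `≥ 57/64` (product pair, `theta_fourteen_bounds`) and `≤ 61/64` (`isolation_fourteen_61`).  The window `(57/64, 61/64]` stays
OPEN.  Finite-slice verdict; NOT summit progress. [this work] -/
theorem theta_fourteen_window_61 : ∃ θ₀ : ℝ, 57 / 64 ≤ θ₀ ∧ θ₀ ≤ 61 / 64 ∧
    IsLeast {θ : ℝ | ∀ f g : (Fin 14 → Bool) → Bool, IsDegLeFun 3 f → IsDegLeFun 3 g →
      θ < forrelation f g → forrelation f g = 1} θ₀ := by
  obtain ⟨θ₀, hθ₀⟩ := theta_exists 14
  exact ⟨θ₀, theta_fourteen_bounds.2 θ₀ hθ₀.1, hθ₀.2 isolation_fourteen_61, hθ₀⟩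

end Summit.QuantumAdvantage.QuantumAdvantage.Theorems.NearExactIsExact.Negative.ThetaFourteenSixtyOne

end
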